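import Summits.RiemannHypothesis.RiemannHypothesis.Theorems.WeilWindowFlowWindowLipschitzStubSupBound
import Summits.RiemannHypothesis.RiemannHypothesis.Theorems.WeilWindowFlowWindowLipschitzStubEulerLagrange
import Summits.RiemannHypothesis.RiemannHypothesis.Theorems.WeilWindowFlowWindowLipschitzStubGroundStateEnergy
import Summits.RiemannHypothesis.RiemannHypothesis.Theorems.WeilWindowFlowWindowLipschitzStubFormDomainPos

/-!
# Toolkit for stub `stub_comparison` (S3) of line `borderline-barrier`, crux `WeilWindowFlow.WindowLipschitz`
(item stmt-RiemannHypothesis-1039)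

Elementary pieces of the weak maximum principle against the barrier-shifted truncation
`W = (Re v − K₁ B)⁺` of a ground state `v`: the Markov inequalities
`(Δ Re v)(ΔW) ≥ K₁ (ΔB)(ΔW) ≥ −K₁β₀(W p + W q)`, the `L¹` bound `‖v‖₁ ≤ a + 1/2`, the pole lower bound
`−4e^{2A}‖v‖₁‖W‖₁`, the prime-atom lower bound `−2K₁β₀ S ∫W`, and the energy bound
`D_t(W) ≤ 2D_t(v) + 2K₁² D_t(B)`.

## References

* P. A. Feulefack, S. Jarohs, T. Weth, arXiv:2010.10448, §3 (the truncation test).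
* H. Chen, T. Weth, arXiv:1710.03416, §§3–4 (weak maximum principle for the logarithmic Laplacian).
-/

set_option linter.dupNamespace false

noncomputable section

open MeasureTheory Set Filter
open scoped Topology ENNReal NNReal ComplexConjugate

namespace Summit.RiemannHypothesis.RiemannHypothesis.Theorems.WeilWindowFlowWindowLipschitz

open Literature.NumberTheory.LFunctions

/-! ## Small lemmas -/

/-- Markov inequality for the positive part: `(p − q)(p⁺ − q⁺) ≥ 0`. [folklore] -/
theorem stub_comparison_markov : ∀ p q : ℝ, 0 ≤ (p - q) * (max p 0 - max q 0) := by
  intro p q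
  rcases le_total q p with h | h
  · exact mul_nonneg (sub_nonneg.2 h) (sub_nonneg.2 (max_le_max h le_rfl))
  · exact mul_nonneg_of_nonpos_of_nonpos (sub_nonpos.2 h) (sub_nonpos.2 (max_le_max h le_rfl))

/-- **The barrier-shifted Markov inequality.** With `W = (R − K₁ B)⁺`, `0 ≤ B ≤ β₀`, `0 ≤ K₁`:
`(R p − R q)(W p − W q) ≥ K₁ (B p − B q)(W p − W q) ≥ −K₁ β₀ (W p + W q)`. [folklore] -/
theorem stub_comparison_markovB {R B : ℝ → ℝ} {K₁ β₀ : ℝ} (hK₁ : 0 ≤ K₁)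
    (hB : ∀ x, 0 ≤ B x ∧ B x ≤ β₀) (p q : ℝ) :
    K₁ * ((B p - B q) * (max (R p - K₁ * B p) 0 - max (R q - K₁ * B q) 0)) ≤
      (R p - R q) * (max (R p - K₁ * B p) 0 - max (R q - K₁ * B q) 0) ∧
    -(K₁ * β₀ * (max (R p - K₁ * B p) 0 + max (R q - K₁ * B q) 0)) ≤
      K₁ * ((B p - B q) * (max (R p - K₁ * B p) 0 - max (R q - K₁ * B q) 0)) := by
  set Wp := max (R p - K₁ * B p) 0
  set Wq := max (R q - K₁ * B q) 0
  have hm := stub_comparison_markov (R p - K₁ * B p) (R q - K₁ * B q)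
  refine ⟨by nlinarith [hm], ?_⟩
  have hWp : 0 ≤ Wp := le_max_right _ _
  have hWq : 0 ≤ Wq := le_max_right _ _
  have hdB : |B p - B q| ≤ β₀ := by
    rw [abs_le]
    constructor <;> linarith [(hB p).1, (hB p).2, (hB q).1, (hB q).2]
  have hdW : |Wp - Wq| ≤ Wp + Wq := by
    rw [abs_le]
    constructor <;> linarith
  have h1 : |(B p - B q) * (Wp - Wq)| ≤ β₀ * (Wp + Wq) := by
    rw [abs_mul]
    exact mul_le_mul hdB hdW (abs_nonneg _) (le_trans (abs_nonneg _) hdB)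
  have h2 := neg_abs_le ((B p - B q) * (Wp - Wq))
  nlinarith [h1, h2]

/-- `‖u‖₁ ≤ a + 1/2` for a ground state of the window `[-a, a]` vanishing off the window
(`|u| ≤ (1 + |u|²)/2`, `∫|u|² = 1`). [folklore] -/
theorem stub_comparison_l1_le {a : ℝ} {u : ℝ → ℂ} (hu : IsWeilGroundState a u)
    (hu0 : ∀ x, x ∉ Icc (-a) a → u x = 0) : ∫ x, ‖u x‖ ≤ a + 1 / 2 := by
  have ha := hu.pos
  have h2 : Integrable (fun x ↦ ‖u x‖ ^ 2) :=
    (memLp_two_iff_integrable_sq_norm hu.memLp.1).1 hu.memLp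
  have hind : Integrable ((Icc (-a) a).indicator (fun _ ↦ (1 : ℝ))) :=
    (integrable_indicator_iff measurableSet_Icc).2
      (integrableOn_const (by rw [Real.volume_Icc]; exact ENNReal.ofReal_ne_top))
  calc ∫ x, ‖u x‖ ≤ ∫ x, ((Icc (-a) a).indicator (fun _ ↦ (1 : ℝ)) x + ‖u x‖ ^ 2) / 2 := by
        refine integral_mono hu.integrable.norm ((hind.add h2).div_const 2) fun x ↦ ?_
        by_cases hx : x ∈ Icc (-a) a
        · dsimp only
          rw [indicator_of_mem hx]
          nlinarith [sq_nonneg (‖u x‖ - 1)]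
        · simp [hu0 x hx, hx]
    _ = (volume.real (Icc (-a) a) + ∫ x, ‖u x‖ ^ 2) / 2 := by
        rw [integral_div, integral_add hind h2, integral_indicator_const _ measurableSet_Icc,
          smul_eq_mul, mul_one]
    _ = a + 1 / 2 := by
        rw [hu.integral_norm_sq, Real.volume_real_Icc_of_le (by linarith)]
        ring

/-- **The pole term is `O_A(‖u‖₁ ‖W‖₁)`**: for `u`, `W` vanishing off `[-a, a] ⊆ [-A, A]`,
`Re[2(∫u ch)conj(∫W ch)] − Re[2(∫u sh)conj(∫W sh)] ≥ −4e^{2A}‖u‖₁‖W‖₁`. [folklore] -/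
theorem stub_comparison_pole_re_lower {u : ℝ → ℂ} {W : ℝ → ℝ} {a A : ℝ} (haA : a ≤ A)
    (hu1 : Integrable u) (hu0 : ∀ x, x ∉ Icc (-a) a → u x = 0)
    (hW1 : Integrable (fun x ↦ (W x : ℂ))) (hW0 : ∀ x, x ∉ Icc (-a) a → W x = 0) :
    -(4 * Real.exp A ^ 2 * (∫ x, ‖u x‖) * ∫ x, ‖(W x : ℂ)‖) ≤
      (2 * (∫ x, u x * (Real.cosh (x / 2) : ℂ)) *
          conj (∫ x, (W x : ℂ) * (Real.cosh (x / 2) : ℂ))).re -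
      (2 * (∫ x, u x * (Real.sinh (x / 2) : ℂ)) *
          conj (∫ x, (W x : ℂ) * (Real.sinh (x / 2) : ℂ))).re := by
  have hWC0 : ∀ x, x ∉ Icc (-a) a → (W x : ℂ) = 0 := fun x hx ↦ by
    rw [hW0 x hx, Complex.ofReal_zero]
  have b1 := stub_supBound_norm_integral_mul_le hu1 hu0
    (fun x hx ↦ (stub_supBound_cosh_sinh_le haA hx).1)
  have b2 := stub_supBound_norm_integral_mul_le hW1 hWC0
    (fun x hx ↦ (stub_supBound_cosh_sinh_le haA hx).1)
  have b3 := stub_supBound_norm_integral_mul_le hu1 hu0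
    (fun x hx ↦ (stub_supBound_cosh_sinh_le haA hx).2)
  have b4 := stub_supBound_norm_integral_mul_le hW1 hWC0
    (fun x hx ↦ (stub_supBound_cosh_sinh_le haA hx).2)
  have hNu : 0 ≤ ∫ x, ‖u x‖ := integral_nonneg fun _ ↦ norm_nonneg _
  have key : ∀ I₁ I₂ : ℂ, ‖I₁‖ ≤ Real.exp A * ∫ x, ‖u x‖ → ‖I₂‖ ≤ Real.exp A * ∫ x, ‖(W x : ℂ)‖ →
      |(2 * I₁ * conj I₂).re| ≤ 2 * Real.exp A ^ 2 * (∫ x, ‖u x‖) * ∫ x, ‖(W x : ℂ)‖ := by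
    intro I₁ I₂ h1 h2
    calc |(2 * I₁ * conj I₂).re| ≤ ‖2 * I₁ * conj I₂‖ := Complex.abs_re_le_norm _
      _ = 2 * (‖I₁‖ * ‖I₂‖) := by
          rw [norm_mul, norm_mul, Complex.norm_conj, Complex.norm_two]
          ring
      _ ≤ 2 * ((Real.exp A * ∫ x, ‖u x‖) * (Real.exp A * ∫ x, ‖(W x : ℂ)‖)) :=
          mul_le_mul_of_nonneg_left (mul_le_mul h1 h2 (norm_nonneg _)
            (mul_nonneg (Real.exp_pos A).le hNu)) two_pos.le
      _ = 2 * Real.exp A ^ 2 * (∫ x, ‖u x‖) * ∫ x, ‖(W x : ℂ)‖ := by ring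
  have k1 := key _ _ b1 b2
  have k2 := key _ _ b3 b4
  rw [abs_le] at k1 k2
  linarith [k1.1, k2.2]

/-- **The prime atoms against the barrier-shifted truncation** are `≥ −2K₁β₀ (Σ Λ/√n) ∫W`.
[folklore] -/
theorem stub_comparison_sum_re_lower {u : ℝ → ℂ} {W B : ℝ → ℝ} {K₁ β₀ : ℝ}
    (hu : MemLp u 2) (hW : MemLp (fun x ↦ (W x : ℂ)) 2) (hW1 : Integrable W)
    (hWdef : ∀ x, W x = max ((u x).re - K₁ * B x) 0) (hK₁ : 0 ≤ K₁)
    (hB : ∀ x, 0 ≤ B x ∧ B x ≤ β₀) (s : Finset ℕ) :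
    -(2 * K₁ * β₀ * (∫ x, W x) *
        ∑ n ∈ s, (ArithmeticFunction.vonMangoldt n : ℝ) / Real.sqrt n) ≤
      (∑ n ∈ s, (((ArithmeticFunction.vonMangoldt n : ℝ) / Real.sqrt n : ℝ) : ℂ) *
        ∫ x, (u (x + Real.log n) - u x) *
          conj (((W (x + Real.log n) : ℝ) : ℂ) - ((W x : ℝ) : ℂ))).re := by
  rw [Complex.re_sum, Finset.mul_sum, ← Finset.sum_neg_distrib]
  refine Finset.sum_le_sum fun n _ ↦ ?_
  rw [Complex.re_ofReal_mul, stub_supBound_re_crossIncrement hu hW]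
  have hc : 0 ≤ (ArithmeticFunction.vonMangoldt n : ℝ) / Real.sqrt n :=
    div_nonneg ArithmeticFunction.vonMangoldt_nonneg (Real.sqrt_nonneg _)
  set ℓ : ℝ := Real.log n
  have hWt : Integrable (fun x ↦ W (x + ℓ)) :=
    hW1.comp_add_right ℓ
  -- pointwise lower bound `−K₁β₀ (W(x+ℓ) + W x)`
  have hpt : ∀ x, -(K₁ * β₀ * (W (x + ℓ) + W x)) ≤
      ((u (x + ℓ)).re - (u x).re) * (W (x + ℓ) - W x) := by
    intro x
    have h := stub_comparison_markovB (R := fun y ↦ (u y).re) hK₁ hB (x + ℓ) x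
    rw [hWdef (x + ℓ), hWdef x]
    exact h.2.trans h.1
  have hlow : Integrable (fun x ↦ -(K₁ * β₀ * (W (x + ℓ) + W x))) :=
    ((hWt.add hW1).const_mul (K₁ * β₀)).neg
  have hint : ∫ x, -(K₁ * β₀ * (W (x + ℓ) + W x)) = -(2 * K₁ * β₀ * ∫ x, W x) := by
    rw [integral_neg, integral_const_mul, integral_add hWt hW1, integral_add_right_eq_self W ℓ]
    ring
  have hprod : Integrable (fun x ↦ ((u (x + ℓ)).re - (u x).re) * (W (x + ℓ) - W x)) := by
    have h1 : MemLp (fun x ↦ u (x + ℓ) - u x) 2 :=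
      (hu.comp_measurePreserving (measurePreserving_add_right volume ℓ)).sub hu
    have hWr : MemLp W 2 := by simpa using hW.re
    have h2 : MemLp (fun x ↦ W (x + ℓ) - W x) 2 :=
      (hWr.comp_measurePreserving (measurePreserving_add_right volume ℓ)).sub hWr
    have h3 : MemLp (fun x ↦ (u (x + ℓ) - u x).re) 2 := by simpa using h1.re
    have h4 := h3.integrable_mul h2
    refine h4.congr (Eventually.of_forall fun x ↦ ?_)
    simp only [Pi.mul_apply, Complex.sub_re]
  have hmono := integral_mono hlow hprod hpt
  rw [hint] at hmono
  calc -(2 * K₁ * β₀ * (∫ x, W x) * ((ArithmeticFunction.vonMangoldt n : ℝ) / Real.sqrt n))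
      = (ArithmeticFunction.vonMangoldt n : ℝ) / Real.sqrt n * -(2 * K₁ * β₀ * ∫ x, W x) := by
        ring
    _ ≤ (ArithmeticFunction.vonMangoldt n : ℝ) / Real.sqrt n *
          ∫ x, ((u (x + ℓ)).re - (u x).re) * (W (x + ℓ) - W x) :=
        mul_le_mul_of_nonneg_left hmono hc


/-- **Energy of the barrier-shifted truncation.** For `W = (Re v − K₁B)⁺`:
`D_t(W) ≤ 2 D_t(v) + 2 K₁² D_t(B)`. [folklore] -/
theorem stub_comparison_weilIncrement_le {v : ℝ → ℂ} {W B : ℝ → ℝ} {K₁ : ℝ}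
    (hv : MemLp v 2) (hB2 : MemLp (fun x ↦ (B x : ℂ)) 2) (hWC : MemLp (fun x ↦ (W x : ℂ)) 2)
    (hWdef : ∀ x, W x = max ((v x).re - K₁ * B x) 0) (t : ℝ) :
    weilIncrement (fun x ↦ (W x : ℂ)) t ≤
      2 * weilIncrement v t + 2 * K₁ ^ 2 * weilIncrement (fun x ↦ (B x : ℂ)) t := by
  unfold weilIncrement
  have i1 := integrable_weilIncrement_integrand hv t
  have i2 := integrable_weilIncrement_integrand hB2 t
  have i3 := integrable_weilIncrement_integrand hWC t
  rw [← integral_const_mul, ← integral_const_mul, ← integral_add (i1.const_mul 2)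
    (i2.const_mul (2 * K₁ ^ 2))]
  refine integral_mono i3 ((i1.const_mul 2).add (i2.const_mul (2 * K₁ ^ 2))) fun x ↦ ?_
  dsimp only
  rw [← Complex.ofReal_sub, Complex.norm_real, Real.norm_eq_abs, ← Complex.ofReal_sub,
    Complex.norm_real, Real.norm_eq_abs, hWdef (x + t), hWdef x]
  have h1 : |max ((v (x + t)).re - K₁ * B (x + t)) 0 - max ((v x).re - K₁ * B x) 0| ≤
      |((v (x + t)).re - K₁ * B (x + t)) - ((v x).re - K₁ * B x)| :=
    abs_max_sub_max_le_abs _ _ _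
  have h2 : |((v (x + t)).re - K₁ * B (x + t)) - ((v x).re - K₁ * B x)| ≤
      ‖v (x + t) - v x‖ + |K₁| * |B (x + t) - B x| := by
    have h3 : |(v (x + t)).re - (v x).re| ≤ ‖v (x + t) - v x‖ := by
      rw [← Complex.sub_re]
      exact Complex.abs_re_le_norm _
    calc |((v (x + t)).re - K₁ * B (x + t)) - ((v x).re - K₁ * B x)|
        = |((v (x + t)).re - (v x).re) - K₁ * (B (x + t) - B x)| := by ring_nf
      _ ≤ |(v (x + t)).re - (v x).re| + |K₁ * (B (x + t) - B x)| := abs_sub _ _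
      _ ≤ ‖v (x + t) - v x‖ + |K₁| * |B (x + t) - B x| := by rw [abs_mul]; linarith
  have h4 := h1.trans h2
  have hA : 0 ≤ ‖v (x + t) - v x‖ := norm_nonneg _
  have hBn : 0 ≤ |K₁| * |B (x + t) - B x| := by positivity
  have h5 : |max ((v (x + t)).re - K₁ * B (x + t)) 0 - max ((v x).re - K₁ * B x) 0| ^ 2 ≤
      (‖v (x + t) - v x‖ + |K₁| * |B (x + t) - B x|) ^ 2 :=
    pow_le_pow_left₀ (abs_nonneg _) h4 2
  have h6 : (‖v (x + t) - v x‖ + |K₁| * |B (x + t) - B x|) ^ 2 ≤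
      2 * ‖v (x + t) - v x‖ ^ 2 + 2 * K₁ ^ 2 * |B (x + t) - B x| ^ 2 := by
    nlinarith [sq_nonneg (‖v (x + t) - v x‖ - |K₁| * |B (x + t) - B x|), sq_abs K₁]
  exact h5.trans h6

end Summit.RiemannHypothesis.RiemannHypothesis.Theorems.WeilWindowFlowWindowLipschitz

end
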